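import Mathlib
import Summits.AtomisticToContinuum.Crystallization.Theorems.SquareWellLayerCakeGapTwelveToBarlowFiveFoldReduction

/-!
# Five-fold sparsity: the registered stub signature, conditionally

Support for the stub `stub_fiveFoldSparsity` of line `Sketch` of crux stmt-AtomisticToContinuum-15807:
verbatim the registered signature behind the two geometric hypotheses (NO HOLES, SUB-CUBIC
FIVE-FOLD COUNT) of `fiveFoldSparsity_of_noHoles_of_subcubic`.  The stub's own first hypothesis
(the sign lemma `stub_noSixCommonNeighbours`) is not used by the counting — it is consumed inside
any proof of the sub-cubic count — and is discarded here.
-/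

noncomputable section

namespace Summit.AtomisticToContinuum.Crystallization.Theorems.SquareWellLayerCakeGapTwelveToBarlow

/-- **The registered stub `stub_fiveFoldSparsity`, conditionally**: verbatim its signature behind
NO HOLES (`hNoHoles`) and the SUB-CUBIC FIVE-FOLD COUNT (`hSubcubic`); the sign-lemma hypothesis of
the stub is discarded (not needed by the counting). -/
theorem stub_fiveFoldSparsity_of_noHoles_of_subcubic :
    (∃ c : ℝ, 0 < c ∧ ∃ D₀ : ℝ, ∀ (N : ℕ) (x : Fin N → EuclideanSpace ℝ (Fin 3))
      (i : Fin N) (D : ℝ), D₀ ≤ D →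
      (∀ j : Fin N, dist (x i) (x j) ≤ 2 * D →
        ((∀ j' : Fin N, dist (x j) (x j') ≤ 11 / 10 → ∀ k : Fin N, k ≠ j' →
            (55 : ℝ) / 57 ≤ dist (x j') (x k)) ∧
          (Finset.univ.filter fun j' : Fin N => j' ≠ j ∧ dist (x j) (x j') ≤ 1).card = 12 ∧
          (Finset.univ.filter fun j' : Fin N => j' ≠ j ∧ dist (x j) (x j') ≤ 11 / 10).card ≤ 12)) →
      c * D ^ 3 ≤ (Finset.univ.filter fun j : Fin N => dist (x i) (x j) ≤ D).card) →
    (∀ ε : ℝ, 0 < ε → ∀ D₁ : ℝ, ∃ D : ℝ, D₁ ≤ D ∧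
      ∀ (N : ℕ) (x : Fin N → EuclideanSpace ℝ (Fin 3)) (i : Fin N),
      (∀ j : Fin N, dist (x i) (x j) ≤ 2 * D →
        ((∀ j' : Fin N, dist (x j) (x j') ≤ 11 / 10 → ∀ k : Fin N, k ≠ j' →
            (55 : ℝ) / 57 ≤ dist (x j') (x k)) ∧
          (Finset.univ.filter fun j' : Fin N => j' ≠ j ∧ dist (x j) (x j') ≤ 1).card = 12 ∧
          (Finset.univ.filter fun j' : Fin N => j' ≠ j ∧ dist (x j) (x j') ≤ 11 / 10).card ≤ 12)) →
      ((Finset.univ.filter fun j : Fin N => dist (x i) (x j) ≤ D ∧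
          ∃ k : Fin N, j ≠ k ∧ dist (x j) (x k) ≤ 1 ∧
            (Finset.univ.filter fun l : Fin N =>
              l ≠ j ∧ l ≠ k ∧ dist (x j) (x l) ≤ 1 ∧ dist (x k) (x l) ≤ 1).card = 5).card : ℝ) ≤
        ε * D ^ 3) →
    (∀ (N : ℕ) (x : Fin N → EuclideanSpace ℝ (Fin 3)) (i j : Fin N), i ≠ j →
      (∀ k l : Fin N, k ≠ l → (55 : ℝ) / 57 ≤ dist (x k) (x l)) → dist (x i) (x j) ≤ 1 →
      (Finset.univ.filter fun k : Fin N =>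
        k ≠ i ∧ k ≠ j ∧ dist (x i) (x k) ≤ 1 ∧ dist (x j) (x k) ≤ 1).card ≤ 5) →
    ∀ x : (N : ℕ) → (Fin N → EuclideanSpace ℝ (Fin 3)),
      Filter.Tendsto (fun N : ℕ => (Nat.card {i : Fin N // ¬ (
          (∀ j : Fin N, dist (x N i) (x N j) ≤ 11 / 10 → ∀ k : Fin N, k ≠ j → (55 : ℝ) / 57 ≤ dist (x N j) (x N k)) ∧
          (Finset.univ.filter fun j : Fin N => j ≠ i ∧ dist (x N i) (x N j) ≤ 1).card = 12 ∧
          (Finset.univ.filter fun j : Fin N => j ≠ i ∧ dist (x N i) (x N j) ≤ 11 / 10).card ≤ 12)} : ℝ) / N)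
        Filter.atTop (nhds 0) →
      ∀ R : ℝ, 0 < R →
        Filter.Tendsto (fun N : ℕ => (Nat.card {i : Fin N // ∃ j k : Fin N,
          (j ≠ k ∧ dist (x N j) (x N k) ≤ 1 ∧
            (Finset.univ.filter fun l : Fin N =>
              l ≠ j ∧ l ≠ k ∧ dist (x N j) (x N l) ≤ 1 ∧ dist (x N k) (x N l) ≤ 1).card = 5) ∧
          dist (x N i) (x N j) ≤ R} : ℝ) / N)
          Filter.atTop (nhds 0) :=
  fun hNoHoles hSubcubic _ => fiveFoldSparsity_of_noHoles_of_subcubic hNoHoles hSubcubic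

end Summit.AtomisticToContinuum.Crystallization.Theorems.SquareWellLayerCakeGapTwelveToBarlow

end
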